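import Mathlib

/-!
# Characteristic polynomial of an anti-diagonal block matrix (solo-Langlands-blind, s7)

Kernel anchor for §5.12(c) of the dihedral door (HOME/paper/dihedral-descent.md): at a prime of
reflection type, a Frobenius element acting through a 2-cycle of the induced representation is an
anti-diagonal block matrix `fromBlocks 0 A B 0`, and its characteristic polynomial is
`det (X² − B A)` — the quadratic Frobenius factor `det (X² − ρ(Frob_{u_j}))` of the Hecke polynomial.

Pure linear algebra over a commutative ring; the proof is the block-multiplication trick used for
`Matrix.charpoly_mul_comm'` in Mathlib.
-/

namespace Summit.Langlands.Langlands.Theorems.SoloBlind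

open Polynomial Matrix

variable {ι R : Type*} [Fintype ι] [DecidableEq ι] [CommRing R]

/-- The characteristic matrix of `fromBlocks 0 A B 0` in block form. -/
theorem charmatrix_fromBlocks_zero_zero (A B : Matrix ι ι R) :
    (Matrix.fromBlocks 0 A B 0).charmatrix =
      Matrix.fromBlocks (scalar ι (X : R[X])) (-A.map C) (-B.map C) (scalar ι X) := by
  ext (i | i) (j | j)
  · by_cases h : i = j
    · subst h; simp [charmatrix_apply_eq]
    · simp [h]
  · simp [charmatrix_apply_ne]
  · simp [charmatrix_apply_ne]
  · by_cases h : i = j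
    · subst h; simp [charmatrix_apply_eq]
    · simp [h]

/-- **Characteristic polynomial of an anti-diagonal block matrix**:
`charpoly (fromBlocks 0 A B 0) = det (X² · 1 − B A)`. -/
theorem charpoly_fromBlocks_zero_zero (A B : Matrix ι ι R) :
    (Matrix.fromBlocks 0 A B 0).charpoly =
      (scalar ι ((X : R[X]) ^ 2) - (B * A).map C).det := by
  classical
  set M : Matrix (ι ⊕ ι) (ι ⊕ ι) R[X] :=
    Matrix.fromBlocks (scalar ι (X : R[X])) (-A.map C) (-B.map C) (scalar ι X) with hMdef
  set N : Matrix (ι ⊕ ι) (ι ⊕ ι) R[X] :=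
    Matrix.fromBlocks (1 : Matrix ι ι R[X]) (A.map C) 0 (scalar ι X) with hNdef
  have hcomm : scalar ι (X : R[X]) * A.map C = A.map C * scalar ι X :=
    scalar_comm _ (fun r' => Commute.all _ _) _
  have hMN : M * N =
      Matrix.fromBlocks (scalar ι (X : R[X])) 0 (-B.map C)
        (scalar ι ((X : R[X]) ^ 2) - (B * A).map C) := by
    rw [hMdef, hNdef, fromBlocks_multiply]
    congr 1
    · simp
    · rw [hcomm, Matrix.neg_mul, add_neg_cancel]
    · simp
    · rw [Matrix.neg_mul, ← Matrix.map_mul, sq, map_mul]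
      abel
  have hN : N.det = (X : R[X]) ^ Fintype.card ι := by
    rw [hNdef, det_fromBlocks_zero₂₁, det_one, one_mul, scalar_apply, det_diagonal,
      Finset.prod_const, Finset.card_univ]
  have hM : (X : R[X]) ^ Fintype.card ι * M.det =
      (X : R[X]) ^ Fintype.card ι * (scalar ι ((X : R[X]) ^ 2) - (B * A).map C).det := by
    calc (X : R[X]) ^ Fintype.card ι * M.det = (M * N).det := by rw [det_mul, hN, mul_comm]
      _ = _ := by
        rw [hMN, det_fromBlocks_zero₁₂, scalar_apply, det_diagonal, Finset.prod_const,
          Finset.card_univ]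
  rw [charpoly, charmatrix_fromBlocks_zero_zero, ← hMdef]
  exact (isRegular_X_pow (Fintype.card ι)).left hM

/-- The same with `A B` in place of `B A` (the two orders give the same polynomial). -/
theorem charpoly_fromBlocks_zero_zero' (A B : Matrix ι ι R) :
    (Matrix.fromBlocks 0 A B 0).charpoly =
      (scalar ι ((X : R[X]) ^ 2) - (A * B).map C).det := by
  have h := charpoly_fromBlocks_zero_zero B A
  rw [← h]
  have : Matrix.fromBlocks 0 A B 0 =
      Matrix.reindex (Equiv.sumComm ι ι) (Equiv.sumComm ι ι) (Matrix.fromBlocks 0 B A 0) := by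
    ext (i | i) (j | j) <;> rfl
  rw [this, charpoly_reindex]

/-- **Hecke polynomial at a cubic reflection prime** (g = 3 of §5.12(c)): a Frobenius element
acting on the induced representation through one fixed place (`D = ρ(Frob_{u_0})`) and one 2-cycle
(`A`, `B` with `B A = ρ(Frob_{u_1})`) has characteristic polynomial
`charpoly D · det (X² − B A)`. -/
theorem charpoly_reflection_cubic {κ : Type*} [Fintype κ] [DecidableEq κ]
    (D : Matrix κ κ R) (A B : Matrix ι ι R) :
    (Matrix.fromBlocks D 0 0 (Matrix.fromBlocks 0 A B 0)).charpoly =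
      D.charpoly * (scalar ι ((X : R[X]) ^ 2) - (B * A).map C).det := by
  rw [Matrix.charpoly_fromBlocks_zero₁₂, charpoly_fromBlocks_zero_zero]

/-- Inductive form for general odd g (§5.12(c)): adjoining one more 2-cycle multiplies the
characteristic polynomial by one more quadratic Frobenius factor. -/
theorem charpoly_adjoin_twoCycle {κ : Type*} [Fintype κ] [DecidableEq κ]
    (E : Matrix κ κ R) (A B : Matrix ι ι R) (P : R[X]) (hE : E.charpoly = P) :
    (Matrix.fromBlocks E 0 0 (Matrix.fromBlocks 0 A B 0)).charpoly =
      P * (scalar ι ((X : R[X]) ^ 2) - (B * A).map C).det := by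
  rw [Matrix.charpoly_fromBlocks_zero₁₂, charpoly_fromBlocks_zero_zero, hE]

omit [DecidableEq ι] in
/-- Trace consequence used in §5.12(d): an anti-diagonal block matrix has trace zero, so at a
reflection prime only the degree-one place contributes to the Hecke trace. -/
theorem trace_fromBlocks_zero_zero (A B : Matrix ι ι R) :
    (Matrix.fromBlocks (0 : Matrix ι ι R) A B 0).trace = 0 := by
  simp [Matrix.trace, Fintype.sum_sum_type]

end Summit.Langlands.Langlands.Theorems.SoloBlind
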